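import Mathlib
import HarnessLib
import Summits.ValiantsHypothesis.ValiantsHypothesis.Theorems.LacunarySymmetroidMatrixDescartesProductPlusOneEulerRolle
import Summits.ValiantsHypothesis.ValiantsHypothesis.Theorems.LacunarySymmetroidMatrixDescartesProductPlusOneSharpKSector
import Summits.ValiantsHypothesis.ValiantsHypothesis.Theorems.LacunarySymmetroidMatrixDescartesProductPlusOneSharpKStrictAnti

/-!
# ValiantsHypothesis / LacunarySymmetroid — crux `MatrixDescartes` (stmt-ValiantsHypothesis-18050, V1),
# LINE (A) «product_plus_one», S4″/`EulerBoundPoly` currency: the c-free Euler bound in the GENERAL-K SHARP SECTOR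

The general form of ✓ `…ProductPlusOneEulerSectors` (K = 3):

* `euler_pos_roots_le_general` — for ANY product `P = ∏_j f_j ≠ 0` of real polynomials, a real level `ν` and `Z₊(P) ≤ B`: if
  `Φ = Σ_j x f_j′/f_j` takes the value `ν` at most once on every zero-free interval of `(0,∞)`, then `Z₊(X·P′ − ν·P) ≤ B + (B + 1)`;
* `eulerNumerator_eq_general` — the line's `eulerNumerator d a l₀` (every `K`, unfolded verbatim) is `X·P′ − (m·d_{l₀})·P` for
  `P = ∏_j fewnomial d (a j)` (p7 g14's ✓ `euler_prod` + ✓ `euler_fewnomial`);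
* ★ `sharpK_euler_pos_roots` — m sharp `(K+1)`-nomials on a common support (p7 g14's range-indexed shape), ANY real level `ν`:
  `Z₊(X·P′ − C ν·P) ≤ 2Km + 1`;
* ★ `eulerBound_sharpK` — the ALL-SHARP sector of every format: `2 ≤ K`, `d` strictly increasing, all `a j l ≠ 0`, every factor with
  `K − 1` positive zeros (Descartes-sharp), ANY coupled letter `l₀` ⇒ `Z₊(eulerNumerator d a l₀) ≤ 2 (K−1) m + 1`
  (✓ `sharp_phi_strictAnti`: each `x f_j′/f_j` is strictly decreasing on zero-free intervals, so `Φ` is; ✓ `prod_sparse_pos_roots_le`).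

This is the Euler-currency companion of p7 g14's member count ✓ `sharpK_sector_class` (`Z₊(member) ≤ 2((K−1)m+1)`), i.e. the sharp
sector of `EulerBoundPoly` / BA (val-idea-25's level-budget additivity: here every factor has slack 0 and the bound is forced
crossings + 1 + multiple zeros).  Honest framing: a sector rung; NOT `stub_eulerBoundK3` / `stub_polyLaw` / `MatrixDescartes` / B;
`VP ≠ VNP` NOT proved.  No definitions, no named facts.
-/

set_option linter.dupNamespace false

namespace Summit.ValiantsHypothesis.ValiantsHypothesis.Theorems.LacunarySymmetroidMatrixDescartes

namespace ProductPlusOne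

open Polynomial Finset
open scoped BigOperators

/-! ### §1 The generic count, any product -/

/-- **Generic Euler count, general factors.** `P = ∏ f_j ≠ 0`, `Z₊(P) ≤ B`, and `Φ = Σ_j x·f_j′/f_j` takes the value `ν` at most once
on every zero-free interval ⇒ `Z₊(X·P′ − C ν·P) ≤ B + (B + 1)`. [folklore; fibre count] -/
theorem euler_pos_roots_le_general {m : ℕ} (f : Fin m → ℝ[X]) (hP0 : (∏ j, f j) ≠ 0) (ν : ℝ) (B : ℕ)
    (hZ : ((∏ j, f j).roots.toFinset.filter (fun t => 0 < t)).card ≤ B)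
    (hinj : ∀ w₁ w₂ : ℝ, 0 < w₁ → w₁ < w₂ → (∀ t ∈ Set.Icc w₁ w₂, ∀ j, (f j).eval t ≠ 0) →
      (∑ j, w₁ * (derivative (f j)).eval w₁ / (f j).eval w₁) = ν →
      (∑ j, w₂ * (derivative (f j)).eval w₂ / (f j).eval w₂) = ν → False) :
    ((X * derivative (∏ j, f j) - C ν * ∏ j, f j).roots.toFinset.filter (fun t => 0 < t)).card ≤ B + (B + 1) := by
  classical
  set P : ℝ[X] := ∏ j, f j with hPdef
  set E : ℝ[X] := X * derivative P - C ν * P with hEdef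
  set Zp := P.roots.toFinset.filter (fun t => 0 < t) with hZp
  set S := E.roots.toFinset.filter (fun t => 0 < t) with hSdef
  by_cases hE0 : E = 0
  · have : S = ∅ := by rw [hSdef, hE0, roots_zero, Multiset.toFinset_zero, Finset.filter_empty]
    rw [this, Finset.card_empty]; exact Nat.zero_le _
  have hSmem : ∀ z ∈ S, 0 < z ∧ eval z E = 0 := by
    intro z hz
    rw [hSdef, mem_filter, Multiset.mem_toFinset, mem_roots hE0] at hz
    exact ⟨hz.2, hz.1⟩
  have hPeval : ∀ t : ℝ, eval t P = ∏ j, (f j).eval t := fun t => by rw [hPdef, eval_prod]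
  set S₁ := S.filter (fun z => eval z P = 0) with hS₁
  set S₂ := S.filter (fun z => eval z P ≠ 0) with hS₂
  have hsplit : S.card = S₁.card + S₂.card := by
    rw [hS₁, hS₂]; exact (Finset.card_filter_add_card_filter_not _).symm
  have hS₁le : S₁.card ≤ B := by
    refine le_trans (card_le_card fun z hz => ?_) hZ
    rw [hS₁, mem_filter] at hz
    rw [mem_filter, Multiset.mem_toFinset, mem_roots hP0]
    exact ⟨hz.2, (hSmem z hz.1).1⟩
  have hΦ : ∀ w ∈ S₂, (∀ j, (f j).eval w ≠ 0) ∧ (∑ j, w * (derivative (f j)).eval w / (f j).eval w) = ν := by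
    intro w hw
    rw [hS₂, mem_filter] at hw
    obtain ⟨hwS, hPw⟩ := hw
    have hg : ∀ j, (f j).eval w ≠ 0 := by
      intro j hj
      apply hPw
      rw [hPeval, Finset.prod_eq_zero_iff]
      exact ⟨j, mem_univ _, hj⟩
    refine ⟨hg, ?_⟩
    have hEw := (hSmem w hwS).2
    rw [hEdef, eval_sub, eval_mul, eval_X, eval_mul, eval_C, hPdef, eval_euler_prod_general f hg, eval_prod] at hEw
    rw [hPeval] at hPw
    have := sub_eq_zero.1 hEw
    rw [mul_comm ν] at this
    exact mul_left_cancel₀ hPw this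
  have hfree : ∀ z₁ ∈ S₂, ∀ z₃ ∈ S₂, z₁ < z₃ →
      (Zp.filter (fun t => t < z₁)).card = (Zp.filter (fun t => t < z₃)).card →
      ∀ t ∈ Set.Icc z₁ z₃, ∀ j, (f j).eval t ≠ 0 := by
    intro z₁ hz₁ z₃ hz₃ h13 hk13 t ht j hj
    have hz₁0 : 0 < z₁ := by
      have h := hz₁; rw [hS₂, mem_filter] at h; exact (hSmem z₁ h.1).1
    have ht0 : 0 < t := hz₁0.trans_le ht.1
    have hPt : eval t P = 0 := by
      rw [hPeval, Finset.prod_eq_zero_iff]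
      exact ⟨j, mem_univ _, hj⟩
    rcases eq_or_lt_of_le ht.2 with h | h
    · exact (hΦ z₃ hz₃).1 j (h ▸ hj)
    · have htZ : t ∈ Zp := by
        rw [hZp, mem_filter, Multiset.mem_toFinset, mem_roots hP0]
        exact ⟨hPt, ht0⟩
      have hsub : Zp.filter (fun s => s < z₁) ⊆ Zp.filter (fun s => s < z₃) := by
        intro s hs
        rw [mem_filter] at hs ⊢
        exact ⟨hs.1, hs.2.trans h13⟩
      have hstrict : Zp.filter (fun s => s < z₁) ⊂ Zp.filter (fun s => s < z₃) := by
        refine Finset.ssubset_iff_subset_ne.mpr ⟨hsub, fun heq => ?_⟩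
        have ht1 : t ∈ Zp.filter (fun s => s < z₁) := by
          rw [heq, mem_filter]
          exact ⟨htZ, h⟩
        rw [mem_filter] at ht1
        exact absurd ht1.2 (not_lt.mpr ht.1)
      exact absurd hk13 (Finset.card_lt_card hstrict).ne
  have hfiber : ∀ v ∈ S₂.image (fun z => (Zp.filter (fun t => t < z)).card),
      (S₂.filter (fun z => (Zp.filter (fun t => t < z)).card = v)).card ≤ 1 := by
    intro v _
    rw [Finset.card_le_one]
    intro z₁ hz₁ z₂ hz₂
    rw [mem_filter] at hz₁ hz₂
    by_contra hne
    rcases lt_or_gt_of_ne hne with h12 | h21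
    · have hz₁0 : 0 < z₁ := by
        have h := hz₁.1; rw [hS₂, mem_filter] at h; exact (hSmem z₁ h.1).1
      exact hinj z₁ z₂ hz₁0 h12 (hfree z₁ hz₁.1 z₂ hz₂.1 h12 (hz₁.2.trans hz₂.2.symm)) (hΦ z₁ hz₁.1).2 (hΦ z₂ hz₂.1).2
    · have hz₂0 : 0 < z₂ := by
        have h := hz₂.1; rw [hS₂, mem_filter] at h; exact (hSmem z₂ h.1).1
      exact hinj z₂ z₁ hz₂0 h21 (hfree z₂ hz₂.1 z₁ hz₁.1 h21 (hz₂.2.trans hz₁.2.symm)) (hΦ z₂ hz₂.1).2 (hΦ z₁ hz₁.1).2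
  have himg : S₂.image (fun z => (Zp.filter (fun t => t < z)).card) ⊆ Finset.range (B + 1) := by
    intro v hv
    rw [Finset.mem_image] at hv
    obtain ⟨z, _, rfl⟩ := hv
    rw [Finset.mem_range]
    exact Nat.lt_succ_of_le ((Finset.card_filter_le _ _).trans hZ)
  have hS₂le : S₂.card ≤ B + 1 :=
    calc S₂.card = ∑ v ∈ S₂.image (fun z => (Zp.filter (fun t => t < z)).card),
          (S₂.filter (fun z => (Zp.filter (fun t => t < z)).card = v)).card :=
          Finset.card_eq_sum_card_image _ S₂
      _ ≤ ∑ _v ∈ S₂.image (fun z => (Zp.filter (fun t => t < z)).card), 1 := Finset.sum_le_sum hfiber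
      _ = (S₂.image (fun z => (Zp.filter (fun t => t < z)).card)).card := by
          rw [Finset.sum_const, smul_eq_mul, mul_one]
      _ ≤ B + 1 := (Finset.card_le_card himg).trans (by rw [Finset.card_range])
  rw [hsplit]
  exact Nat.add_le_add hS₁le hS₂le

/-! ### §2 The line's Euler numerator, every `K` -/

/-- **`eulerNumerator d a l₀ = X·P′ − (m·d_{l₀})·P`** for `P = ∏_j Σ_l C (a j l) X^(d l)` (every format; ✓ `euler_prod`,
✓ `euler_fewnomial`). [folklore] -/
theorem eulerNumerator_eq_general {m K : ℕ} (d : Fin K → ℕ) (a : Fin m → Fin K → ℝ) (l₀ : Fin K) :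
    (∑ j, (∑ l, C (a j l * ((d l : ℝ) - d l₀)) * X ^ (d l)) * ∏ i ∈ Finset.univ.erase j, (∑ l, C (a i l) * X ^ (d l)) : ℝ[X])
      = X * derivative (∏ j, ∑ l, C (a j l) * X ^ (d l) : ℝ[X])
        - C ((m : ℝ) * (d l₀ : ℝ)) * ∏ j, ∑ l, C (a j l) * X ^ (d l) := by
  rw [euler_prod]
  refine Finset.sum_congr rfl (fun j _ => ?_)
  rw [euler_fewnomial]

/-! ### §3 The general-K sharp sector -/

/-- ★ **Sharp `(K+1)`-nomials on a common support, ANY real level `ν`** (p7 g14's range-indexed shape): `m` factors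
`Σ_{i ≤ K} c_{ji} X^{d i}` with `d` strictly increasing, all `c_{ji} ≠ 0`, each with `K` positive zeros ⇒
`Z₊(X·P′ − C ν·P) ≤ 2 K m + 1`. [this file's theorem] -/
theorem sharpK_euler_pos_roots {m : ℕ} (K : ℕ) (hK : 1 ≤ K) (d : ℕ → ℕ) (hd : StrictMono d) (c : Fin m → ℕ → ℝ)
    (hc : ∀ j i, i < K + 1 → c j i ≠ 0)
    (hsharp : ∀ j, K ≤ (((∑ i ∈ Finset.range (K + 1), C (c j i) * X ^ (d i) : ℝ[X])).roots.toFinset.filter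
      (fun t => 0 < t)).card) (ν : ℝ) :
    ((X * derivative (∏ j, (∑ i ∈ Finset.range (K + 1), C (c j i) * X ^ (d i) : ℝ[X]))
        - C ν * ∏ j, (∑ i ∈ Finset.range (K + 1), C (c j i) * X ^ (d i) : ℝ[X])).roots.toFinset.filter
      (fun t => 0 < t)).card ≤ 2 * (K * m) + 1 := by
  classical
  rcases Nat.eq_zero_or_pos m with hm | hm
  · subst hm
    simp only [Finset.univ_eq_empty, Finset.prod_empty, derivative_one, mul_zero, zero_sub, mul_one, roots_neg, roots_C,
      Multiset.toFinset_zero, Finset.filter_empty, Finset.card_empty]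
    exact Nat.zero_le _
  obtain ⟨hP0, hZ⟩ := prod_sparse_pos_roots_le K d hd c hc
  have h := euler_pos_roots_le_general (fun j => (∑ i ∈ Finset.range (K + 1), C (c j i) * X ^ (d i) : ℝ[X])) hP0
    ν (K * m) hZ ?_
  · exact h.trans (by omega)
  · intro w₁ w₂ hw₁ hw hfree h1 h2
    have hlt : (∑ j, w₂ * (derivative (∑ i ∈ Finset.range (K + 1), C (c j i) * X ^ (d i) : ℝ[X])).eval w₂
          / (∑ i ∈ Finset.range (K + 1), C (c j i) * X ^ (d i) : ℝ[X]).eval w₂)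
        < ∑ j, w₁ * (derivative (∑ i ∈ Finset.range (K + 1), C (c j i) * X ^ (d i) : ℝ[X])).eval w₁
          / (∑ i ∈ Finset.range (K + 1), C (c j i) * X ^ (d i) : ℝ[X]).eval w₁ :=
      Finset.sum_lt_sum_of_nonempty ⟨⟨0, hm⟩, Finset.mem_univ _⟩ (fun j _ =>
        sharp_phi_strictAnti K hK d hd (c j) (hc j) (hsharp j) hw₁ hw (fun t ht => hfree t ht j))
    rw [h1, h2] at hlt
    exact lt_irrefl _ hlt

/-- ★ **THE c-FREE EULER BOUND IN THE ALL-SHARP SECTOR, every format** (`2 ≤ K`, `d` strictly increasing, all `a j l ≠ 0`, every factor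
with `K − 1` positive zeros, any coupled letter `l₀`): `Z₊(eulerNumerator d a l₀) ≤ 2 (K−1) m + 1`. [this file's theorem] -/
theorem eulerBound_sharpK {m K : ℕ} (hK : 2 ≤ K) (d : Fin K → ℕ) (hd : StrictMono d) (l₀ : Fin K)
    (a : Fin m → Fin K → ℝ) (ha : ∀ j l, a j l ≠ 0)
    (hsharp : ∀ j, K - 1 ≤ (((∑ l, C (a j l) * X ^ (d l) : ℝ[X])).roots.toFinset.filter (fun t => 0 < t)).card) :
    ((∑ j, (∑ l, C (a j l * ((d l : ℝ) - d l₀)) * X ^ (d l)) * ∏ i ∈ Finset.univ.erase j, (∑ l, C (a i l) * X ^ (d l))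
      : ℝ[X]).roots.toFinset.filter (fun t => 0 < t)).card ≤ 2 * ((K - 1) * m) + 1 := by
  classical
  obtain ⟨K', rfl⟩ : ∃ K', K = K' + 1 := ⟨K - 1, by omega⟩
  have hK' : 1 ≤ K' := by omega
  -- extend the support and the coefficient rows to ℕ (as in ✓ `sharpK_sector_class`)
  set dx : ℕ → ℕ := fun i => if h : i < K' + 1 then d ⟨i, h⟩ else d ⟨K', by omega⟩ + (i - K') with hdx
  set cx : Fin m → ℕ → ℝ := fun j i => if h : i < K' + 1 then a j ⟨i, h⟩ else 0 with hcx
  have hdx_in : ∀ i (h : i < K' + 1), dx i = d ⟨i, h⟩ := fun i h => by simp only [hdx]; exact dif_pos h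
  have hdmono : StrictMono dx := by
    intro i j hij
    by_cases hj : j < K' + 1
    · have hi : i < K' + 1 := by omega
      rw [hdx_in i hi, hdx_in j hj]
      exact hd (Fin.mk_lt_mk.mpr hij)
    · have ej : dx j = d ⟨K', by omega⟩ + (j - K') := by simp only [hdx]; exact dif_neg hj
      rw [ej]
      by_cases hi : i < K' + 1
      · rw [hdx_in i hi]
        have : d ⟨i, hi⟩ ≤ d ⟨K', by omega⟩ := hd.monotone (Fin.mk_le_mk.mpr (by omega))
        omega
      · have ei : dx i = d ⟨K', by omega⟩ + (i - K') := by simp only [hdx]; exact dif_neg hi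
        rw [ei]
        omega
  have hcx_ne : ∀ j i, i < K' + 1 → cx j i ≠ 0 := by
    intro j i hi
    simp only [hcx, dif_pos hi]
    exact ha j _
  have hfac : ∀ j, (∑ l, C (a j l) * X ^ (d l) : ℝ[X]) = ∑ i ∈ Finset.range (K' + 1), C (cx j i) * X ^ (dx i) := by
    intro j
    rw [← Fin.sum_univ_eq_sum_range (fun i => C (cx j i) * X ^ (dx i)) (K' + 1)]
    refine Finset.sum_congr rfl (fun l _ => ?_)
    have hl : (l : ℕ) < K' + 1 := l.isLt
    simp only [hcx, hdx, dif_pos hl, Fin.eta]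
  have hsharp' : ∀ j, K' ≤ (((∑ i ∈ Finset.range (K' + 1), C (cx j i) * X ^ (dx i) : ℝ[X])).roots.toFinset.filter
      (fun t => 0 < t)).card := by
    intro j
    rw [← hfac j]
    have := hsharp j
    simpa using this
  rw [eulerNumerator_eq_general, Finset.prod_congr rfl (fun j _ => hfac j)]
  have h := sharpK_euler_pos_roots K' hK' dx hdmono cx hcx_ne hsharp' ((m : ℝ) * (d l₀ : ℝ))
  have e : K' + 1 - 1 = K' := by omega
  rw [e]
  exact h

end ProductPlusOne

end Summit.ValiantsHypothesis.ValiantsHypothesis.Theorems.LacunarySymmetroidMatrixDescartes
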